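import Summits.SmoothPoincare4.SmoothPoincare4.Theorems.SullivanDualTargetStubOmegaFlat
import Summits.SmoothPoincare4.SmoothPoincare4.Theorems.SullivanDualTargetStubInvChartMap
import Summits.SmoothPoincare4.SmoothPoincare4.Theorems.SullivanDualTargetStubFormBound
import Summits.SmoothPoincare4.SmoothPoincare4.Theorems.SullivanDualTargetStubCutoff
import Summits.SmoothPoincare4.SmoothPoincare4.Theorems.SullivanDualTargetStubCtkwOfInputs
import Summits.SmoothPoincare4.SmoothPoincare4.Theorems.SullivanDualAdmissibleJExists
import Summits.SmoothPoincare4.SmoothPoincare4.Theorems.SullivanDualClosedModelExtension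

/-!
# SmoothPoincare4 / SullivanDual — crux `Target` (stmt-SmoothPoincare4-7823), line `Sketch`:
# the reduction `Target ⇐ WeakTameExact`

Route SullivanDual's target `Target` says: on every punctured homotopy 4-sphere `Σ ∖ p` some
smooth almost complex structure `J` has, for all small radii `ε`, NO taming witness
(`Literature.Geometry.Symplectic.TamingWitness`: a linear functional on `2`-forms positive on
the smooth forms taming `J` off the punctured `ε`-chart-ball, zero on the closed smooth forms
vanishing there, non-positive on the closed smooth forms standard there).  This file proves,
unconditionally,

* `closedExactTamingKillsWitnesses`: if `J` is STANDARD on a punctured `ε'`-chart-ball at `p`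
  (`⟪A (J v), b⟫ = ω₀(A v, b)`, `A = Dι(e x − e p) ∘ De_x`) and some smooth `1`-form `γ` has
  `dγ(v, Jv) > 0` for all `v ≠ 0`, then `J` has no taming witness at any radius `0 < ε < ε'`
  (Sullivan's "transversal closed form excludes structure cycles", Sullivan 1976 Thm. I.7, in
  the relative form of the route; proof: the collar lemma and (W2), files
  `SullivanDualTargetStub*`);
* `weakTameExact_clauses_of_nonempty_diffeomorph_sphere`, `target_of_forall_nonempty_diffeomorph_sphere`:
  WeakTameExact — hence `Target` — HOLDS for every homotopy 4-sphere diffeomorphic to `S⁴`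
  (`J = Φ^*J₀`, `γ = Φ^*λ₀`, `λ₀ = -¼ α₀`, `dλ₀ = ω₀`, Palais' chart form `Φ`): the consistency
  direction "SPC4 ⇒ Target" and the non-vacuity of the transferred crux;
* `weakTameExact_of_target`: conversely `Target ⇒ WeakTameExact` modulo the route's own supports
  (`RelativeSullivanDuality`, `GromovChartForm`; `ClosedModelExtension` is landed) — the transfer
  is lossless;
* `target_of_weakTameExact`: `Target` follows from **WeakTameExact** — every `Σ ∖ p`
  carries a smooth `J`, `J² = -1`, standard near `p`, with an exact taming form `dγ` — which
  is the transferred crux of the line (equivalent to `Target` given the route's supports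
  `RelativeSullivanDuality`, `ClosedModelExtension` and Gromov's recognition of `ℝ⁴`; true for
  `Σ ≅ S⁴` with `J = Φ^*J₀`, `γ = Φ^*λ₀`).

References: D. Sullivan, *Cycles for the dynamical study of foliated manifolds and complex
manifolds*, Invent. Math. 36 (1976), Thm. I.7 [Sullivan1976]; M. Gromov, *Pseudo holomorphic
curves in symplectic manifolds*, Invent. Math. 82 (1985), §0.3.C [Gromov1985].
-/

noncomputable section

-- the registered namespace `Summit.SmoothPoincare4.SmoothPoincare4.Theorems` repeats a component
set_option linter.dupNamespace false

open scoped Manifold ContDiff Topology InnerProductSpace RealInnerProductSpace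
open Set Filter Metric Function ContinuousLinearMap
open Literature.Geometry.Kaehler Literature.Geometry.Symplectic

namespace Summit.SmoothPoincare4.SmoothPoincare4.Theorems

namespace SullivanDual

open Literature.Topology.FourManifolds in
/-- **Closed-exact taming kills witnesses.** Let `J` on `Σ ∖ p` be standard on the punctured
`ε'`-chart-ball (closed `ε'`-ball inside the chart target) and let `γ` be a smooth `1`-form with
`dγ_x(v, J v) > 0` for all `v ≠ 0`, everywhere. Then `J` has no taming witness at any radius
`0 < ε < ε'`: the four analytic stubs supply the inputs of `stub_ctkwOfInputs` at radii
`ε < ε₃ < ε₄ < ε'`. [cite: Sullivan1976, Thm. I.7] -/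
theorem closedExactTamingKillsWitnesses (S : HomotopySphere 4) (p : S.carrier)
    (J : ∀ x : punctured p, TangentSpace (𝓡 4) x →L[ℝ] TangentSpace (𝓡 4) x) (ε ε' : ℝ)
    (hε : 0 < ε) (hεε' : ε < ε')
    (hball : Metric.closedBall (extChartAt (𝓡 4) p p) ε' ⊆ (extChartAt (𝓡 4) p).target)
    (hstd : ∀ x : punctured p, InPuncturedChartBall p ε' x →
        ∀ (v : TangentSpace (𝓡 4) x) (b : EuclideanSpace ℝ (Fin 4)),
        inner ℝ (fderiv ℝ inversion (extChartAt (𝓡 4) p x.1 - extChartAt (𝓡 4) p p)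
          (mfderiv (𝓡 4) 𝓘(ℝ, EuclideanSpace ℝ (Fin 4))
            (fun z : punctured p => extChartAt (𝓡 4) p z.1) x (J x v))) b =
        stdSymplecticForm (fderiv ℝ inversion (extChartAt (𝓡 4) p x.1 - extChartAt (𝓡 4) p p)
          (mfderiv (𝓡 4) 𝓘(ℝ, EuclideanSpace ℝ (Fin 4))
            (fun z : punctured p => extChartAt (𝓡 4) p z.1) x v)) b)
    (γ : MForm (𝓡 4) (punctured p) ℝ 1) (hγ : IsSmoothForm γ)
    (htame : ∀ (x : punctured p) (v : TangentSpace (𝓡 4) x), v ≠ 0 →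
        0 < mextDeriv γ x ![v, J x v]) :
    NoWitness p ε J := by
  -- radii `ε < ε₃ < ε₄ < ε'`
  obtain ⟨ε₃, hε₃, hε₃'⟩ : ∃ ε₃, ε < ε₃ ∧ ε₃ < ε' := exists_between hεε'
  obtain ⟨ε₄, hε₄, hε₄'⟩ : ∃ ε₄, ε₃ < ε₄ ∧ ε₄ < ε' := exists_between hε₃'
  have hε₃pos : 0 < ε₃ := hε.trans hε₃
  have hε₄pos : 0 < ε₄ := hε₃pos.trans hε₄
  -- (A) the flat collar form, in inverted coordinates `R₄ = ε₄⁻¹ < R₃ = ε₃⁻¹ < R = ε⁻¹`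
  obtain ⟨Ω, hΩs, hΩc, hΩ0, hΩstd, hΩnn, c, hc, hΩpos⟩ :=
    stub_omegaFlat ε₄⁻¹ ε₃⁻¹ ε⁻¹ (inv_pos.2 hε₄pos) ((inv_lt_inv₀ hε₄pos hε₃pos).2 hε₄)
      ((inv_lt_inv₀ hε₃pos hε).2 hε₃)
  -- (B) the cut-off inverted chart with radius `ε'`
  obtain ⟨Φ, hΦs, hΦeq, hΦle⟩ := stub_invChartMap p ε' (hε.trans hεε') hball
  -- (D) the cut-off for the split `γ = φγ + (1-φ)γ` (`φ = 0` on `B_ε`, `= 1` near `Σ ∖ B_{ε₃}`)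
  obtain ⟨φ, hφs, hφ0, hφ1, -⟩ := stub_cutoff p ε ε₃ hε hε₃
    ((Metric.closedBall_subset_closedBall hε₃'.le).trans hball)
  -- (C) chart-norm bounds of smooth forms on the compact collar `ε ≤ ‖e x - e p‖ ≤ ε₃`
  have hC := fun (α : MForm (𝓡 4) (punctured p) ℝ 2) (hα : IsSmoothForm α) =>
    stub_formBound p α hα ε ε₃ hε hε₃.le
      ((Metric.closedBall_subset_closedBall hε₃'.le).trans hball)
  exact stub_ctkwOfInputs p J hε hε₃ hε₄ hε₄' hstd hγ htame hΩs hΩc hΩ0 hΩstd hΩnn hc hΩpos hΦs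
    hΦeq hΦle hC hφs hφ0 hφ1

open Literature.Topology.FourManifolds in
/-- **`Target ⇐ WeakTameExact`.** If every punctured homotopy 4-sphere carries a smooth almost
complex structure `J` (`J² = -1`), standard on a punctured chart-ball at the puncture whose
closure lies in the chart target, together with a smooth `1`-form `γ` whose exterior derivative
tames `J` everywhere, then route SullivanDual's `Target` holds: take that `J` and `ε₁ := ε'/2`;
`closedExactTamingKillsWitnesses` excludes witnesses at every radius `ε ≤ ε₁ < ε'`.
[cite: Sullivan1976, Thm. I.7] -/
theorem target_of_weakTameExact
    (hE : ∀ (S : HomotopySphere 4) (p : S.carrier),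
    ∃ (J : ∀ x : punctured p, TangentSpace (𝓡 4) x →L[ℝ] TangentSpace (𝓡 4) x) (ε' : ℝ),
      0 < ε' ∧ Metric.closedBall (extChartAt (𝓡 4) p p) ε' ⊆ (extChartAt (𝓡 4) p).target ∧
      (∀ (x : punctured p) (v : TangentSpace (𝓡 4) x), J x (J x v) = -v) ∧
      (∀ x₀ : punctured p, ContMDiffAt (𝓡 4)
        𝓘(ℝ, EuclideanSpace ℝ (Fin 4) →L[ℝ] EuclideanSpace ℝ (Fin 4)) ∞
        (inTangentCoordinates (𝓡 4) (𝓡 4) (id : punctured p → punctured p) id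
          (fun x => J x) x₀) x₀) ∧
      (∀ x : punctured p, InPuncturedChartBall p ε' x →
        ∀ (v : TangentSpace (𝓡 4) x) (b : EuclideanSpace ℝ (Fin 4)),
        inner ℝ (fderiv ℝ inversion (extChartAt (𝓡 4) p x.1 - extChartAt (𝓡 4) p p)
          (mfderiv (𝓡 4) 𝓘(ℝ, EuclideanSpace ℝ (Fin 4))
            (fun z : punctured p => extChartAt (𝓡 4) p z.1) x (J x v))) b =
        stdSymplecticForm (fderiv ℝ inversion (extChartAt (𝓡 4) p x.1 - extChartAt (𝓡 4) p p)
          (mfderiv (𝓡 4) 𝓘(ℝ, EuclideanSpace ℝ (Fin 4))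
            (fun z : punctured p => extChartAt (𝓡 4) p z.1) x v)) b) ∧
      ∃ γ : MForm (𝓡 4) (punctured p) ℝ 1, IsSmoothForm γ ∧
        ∀ (x : punctured p) (v : TangentSpace (𝓡 4) x), v ≠ 0 →
          0 < mextDeriv γ x ![v, J x v]) :
    Summit.SmoothPoincare4.SmoothPoincare4.Theses.SullivanDual.Target := by
  intro S p
  obtain ⟨J, ε', hε', hball, hJ2, hJs, hstd, γ, hγ, htame⟩ := hE S p
  refine ⟨J, hJ2, hJs, ε' / 2, by positivity, fun ε hε hεle T hT => ?_⟩
  have hlt : ε < ε' := lt_of_le_of_lt hεle (by linarith)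
  exact closedExactTamingKillsWitnesses S p J ε ε' hε hlt hball hstd γ hγ htame T hT

/-! ### The standard sphere: `WeakTameExact`, hence `Target`, for `Σ ≅ S⁴` -/

/-- The Liouville-type `1`-form `λ₀ := -¼ α₀` on `ℝ⁴` (`α₀(w)(v) = 2⟪w, J₀ v⟫`, the tree's
`ambAlpha`), as a form on the manifold `ℝ⁴`; `dλ₀ = ω₀`. [folklore] -/
theorem mextDeriv_liouville_eq_stdSymplecticMForm :
    mextDeriv (I := 𝓡 4) (M := EuclideanSpace ℝ (Fin 4))
      (fun w => (-(4 : ℝ)⁻¹) • ambAlpha w) = stdSymplecticMForm := by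
  funext w
  rw [mextDeriv_eq_extDeriv]
  have h : extDeriv (fun w => (-(4 : ℝ)⁻¹) • ambAlpha w) w = (-(4 : ℝ)⁻¹) • extDeriv ambAlpha w :=
    extDeriv_smul (-(4 : ℝ)⁻¹) ambAlpha ▸ rfl
  rw [h]
  ext v
  have hv : v = ![v 0, v 1] := by
    funext i; fin_cases i <;> rfl
  rw [hv, ContinuousAlternatingMap.smul_apply, extDeriv_ambAlpha_apply]
  show _ = stdSymplecticAlt ![v 0, v 1]
  rw [stdSymplecticAlt_apply, inner_stdComplexStructure_right,
    inner_stdComplexStructure_eq_stdSymplecticForm, smul_eq_mul]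
  ring

/-- `λ₀` is a smooth form on `ℝ⁴`. [folklore] -/
theorem isSmoothForm_liouville :
    IsSmoothForm (I := 𝓡 4) (M := EuclideanSpace ℝ (Fin 4)) (fun w => (-(4 : ℝ)⁻¹) • ambAlpha w) :=
  (isSmoothForm_iff_smoothAt _).2 fun z =>
    SphereOpenBook.smoothAt_flat_of_contDiff (contDiff_ambAlpha.const_smul (-(4 : ℝ)⁻¹)) z

section Sphere

variable {M : Type*} [TopologicalSpace M] [T2Space M] [ChartedSpace (EuclideanSpace ℝ (Fin 4)) M]
  [IsManifold (𝓡 4) ∞ M]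

/-- **The clauses of `WeakTameExact` at `(M, p)` from a diffeomorphism `Φ : M ∖ p ≃ ℝ⁴` in
chart form at `p`.** With `Ψ = dΦ`: `J = Ψ⁻¹ J₀ Ψ` (smooth, `J² = -1`, standard on a punctured
chart-ball — the construction of `exists_admissibleJ_of_agreesWithInvertedChartNear`), and the
exact taming form is `d(Φ^*λ₀) = Φ^*ω₀`: `ω₀(Ψ v, Ψ (J v)) = ω₀(Ψ v, J₀ Ψ v) = ‖Ψ v‖² > 0`.
[folklore] -/
theorem weakTameExact_clauses_of_diffeomorph (p : M)
    (Φ : (punctured p) ≃ₘ⟮𝓡 4, 𝓡 4⟯ EuclideanSpace ℝ (Fin 4))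
    (hagree : AgreesWithInvertedChartNear p Φ) :
    ∃ (J : ∀ x : punctured p, TangentSpace (𝓡 4) x →L[ℝ] TangentSpace (𝓡 4) x) (ε' : ℝ),
      0 < ε' ∧ Metric.closedBall (extChartAt (𝓡 4) p p) ε' ⊆ (extChartAt (𝓡 4) p).target ∧
      (∀ (x : punctured p) (v : TangentSpace (𝓡 4) x), J x (J x v) = -v) ∧
      (∀ x₀ : punctured p, ContMDiffAt (𝓡 4)
        𝓘(ℝ, EuclideanSpace ℝ (Fin 4) →L[ℝ] EuclideanSpace ℝ (Fin 4)) ∞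
        (inTangentCoordinates (𝓡 4) (𝓡 4) (id : punctured p → punctured p) id
          (fun x => J x) x₀) x₀) ∧
      (∀ x : punctured p, InPuncturedChartBall p ε' x →
        ∀ (v : TangentSpace (𝓡 4) x) (b : EuclideanSpace ℝ (Fin 4)),
        inner ℝ (fderiv ℝ inversion (extChartAt (𝓡 4) p x.1 - extChartAt (𝓡 4) p p)
          (mfderiv (𝓡 4) 𝓘(ℝ, EuclideanSpace ℝ (Fin 4))
            (fun z : punctured p => extChartAt (𝓡 4) p z.1) x (J x v))) b =
        stdSymplecticForm (fderiv ℝ inversion (extChartAt (𝓡 4) p x.1 - extChartAt (𝓡 4) p p)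
          (mfderiv (𝓡 4) 𝓘(ℝ, EuclideanSpace ℝ (Fin 4))
            (fun z : punctured p => extChartAt (𝓡 4) p z.1) x v)) b) ∧
      ∃ γ : MForm (𝓡 4) (punctured p) ℝ 1, IsSmoothForm γ ∧
        ∀ (x : punctured p) (v : TangentSpace (𝓡 4) x), v ≠ 0 →
          0 < mextDeriv γ x ![v, J x v] := by
  obtain ⟨ε, hε, hagree⟩ := hagree
  -- a closed chart-ball inside the chart target
  obtain ⟨r, hr, hball⟩ : ∃ r > (0 : ℝ),
      Metric.closedBall (extChartAt (𝓡 4) p p) r ⊆ (extChartAt (𝓡 4) p).target := by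
    obtain ⟨r, hr, h⟩ := Metric.isOpen_iff.mp (isOpen_extChartAt_target (I := 𝓡 4) p)
      (extChartAt (𝓡 4) p p) (mem_extChartAt_target (I := 𝓡 4) p)
    exact ⟨r / 2, half_pos hr, (Metric.closedBall_subset_ball (half_lt_self hr)).trans h⟩
  -- the coframe `Ψ = dΦ` and `J = Ψ⁻¹ J₀ Ψ`
  have hn : (∞ : WithTop ℕ∞) ≠ 0 := by simp
  let Ψ : punctured p → EuclideanSpace ℝ (Fin 4) →L[ℝ] EuclideanSpace ℝ (Fin 4) :=
    fun x => mfderiv (𝓡 4) 𝓘(ℝ, EuclideanSpace ℝ (Fin 4)) Φ x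
  have hinv' : ∀ x, (Ψ x).IsInvertible := fun x =>
    ⟨Φ.mfderivToContinuousLinearEquiv hn x, Φ.mfderivToContinuousLinearEquiv_coe hn⟩
  have hΨ : ∀ x₀ : punctured p, ContMDiffAt (𝓡 4)
      𝓘(ℝ, EuclideanSpace ℝ (Fin 4) →L[ℝ] EuclideanSpace ℝ (Fin 4)) ∞
      (inTangentCoordinates (𝓡 4) 𝓘(ℝ, EuclideanSpace ℝ (Fin 4)) (id : punctured p → punctured p)
        Φ Ψ x₀) x₀ :=
    fun x₀ => ContMDiffAt.mfderiv_const (Φ.contMDiff x₀) (by simp)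
  let J : punctured p → EuclideanSpace ℝ (Fin 4) →L[ℝ] EuclideanSpace ℝ (Fin 4) :=
    fun x => (Ψ x).inverse ∘L stdComplexStructure ∘L Ψ x
  -- the exact taming form `γ = Φ^*λ₀`
  set lam : MForm (𝓡 4) (EuclideanSpace ℝ (Fin 4)) ℝ 1 := fun w => (-(4 : ℝ)⁻¹) • ambAlpha w
    with hlam
  have hlam_s : IsSmoothForm lam := isSmoothForm_liouville
  refine ⟨fun x => J x, min ε r, lt_min hε hr,
    (Metric.closedBall_subset_closedBall (min_le_right ε r)).trans hball,
    fun x v => conj_conj stdComplexStructure_sq (hinv' x) v,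
    fun x₀ => contMDiffAt_inTangentCoordinates_conj stdComplexStructure Ψ Φ (hΨ x₀) (hinv' x₀),
    ?_, lam.pullback (𝓡 4) Φ,
    Literature.NumberTheory.Transcendental.isSmoothForm_pullback Φ.contMDiff hlam_s, ?_⟩
  · intro x hx v b
    -- on the punctured ball `Φ` is the inverted chart, so `dΦ_x = Dι(e x − e p) ∘ De_x`
    have hev : (Φ : punctured p → EuclideanSpace ℝ (Fin 4)) =ᶠ[𝓝 x]
        fun z : punctured p => inversion (extChartAt (𝓡 4) p z.1 - extChartAt (𝓡 4) p p) :=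
      Filter.eventuallyEq_of_mem ((isOpen_setOf_inPuncturedChartBall p (min ε r)).mem_nhds hx)
        fun z hz => hagree z hz.1 (Metric.ball_subset_ball (min_le_left ε r) hz.2)
    have hA : Ψ x = (fderiv ℝ inversion (extChartAt (𝓡 4) p x.1 - extChartAt (𝓡 4) p p)).comp
        (mfderiv (𝓡 4) 𝓘(ℝ, EuclideanSpace ℝ (Fin 4))
          (fun z : punctured p => extChartAt (𝓡 4) p z.1) x) :=
      ((hasMFDerivAt_inversion_extChartAt_sub p x hx.1).congr_of_eventuallyEq hev).mfderiv
    have hAw : ∀ w : EuclideanSpace ℝ (Fin 4),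
        fderiv ℝ inversion (extChartAt (𝓡 4) p x.1 - extChartAt (𝓡 4) p p)
          (mfderiv (𝓡 4) 𝓘(ℝ, EuclideanSpace ℝ (Fin 4))
            (fun z : punctured p => extChartAt (𝓡 4) p z.1) x w) = Ψ x w :=
      fun w => by rw [hA]; rfl
    simp only [hAw]
    erw [apply_conj (hinv' x) v]
    rw [inner_stdComplexStructure_eq_stdSymplecticForm]
  · intro x v hv
    rw [Literature.NumberTheory.Transcendental.mextDeriv_pullback Φ.contMDiff hlam_s,
      show mextDeriv lam = stdSymplecticMForm from mextDeriv_liouville_eq_stdSymplecticMForm,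
      stdSymplecticMForm_pullback_apply]
    have h1 : Ψ x (J x v) = stdComplexStructure (Ψ x v) := apply_conj (hinv' x) v
    show 0 < stdSymplecticForm (Ψ x v) (Ψ x (J x v))
    rw [h1, ← inner_stdComplexStructure_eq_stdSymplecticForm,
      inner_stdComplexStructure_stdComplexStructure, real_inner_self_eq_norm_sq]
    obtain ⟨e, he⟩ := hinv' x
    have hne : Ψ x v ≠ 0 := fun h0 => hv (by
      rw [← he] at h0
      exact e.injective (h0.trans (map_zero _).symm))
    exact pow_pos (norm_pos_iff.2 hne) 2

end Sphere

open Literature.Topology.FourManifolds in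
/-- **`WeakTameExact` holds for every homotopy 4-sphere diffeomorphic to `S⁴`**, at every
point: Palais' chart form (`palais_puncturedSphere_chartForm_holds`, proved in the tree) gives
`Φ : Σ ∖ p ≃ₘ ℝ⁴` agreeing with the inverted chart near `p`; then `J = Φ^*J₀`, `γ = Φ^*λ₀`.
So the transferred crux is exactly true in the standard case (non-vacuity of the reduction).
[folklore] -/
theorem weakTameExact_clauses_of_nonempty_diffeomorph_sphere (S : HomotopySphere 4)
    (hS : Nonempty (S.carrier ≃ₘ⟮𝓡 4, 𝓡 4⟯ Metric.sphere (0 : EuclideanSpace ℝ (Fin 5)) 1))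
    (p : S.carrier) :
    ∃ (J : ∀ x : punctured p, TangentSpace (𝓡 4) x →L[ℝ] TangentSpace (𝓡 4) x) (ε' : ℝ),
      0 < ε' ∧ Metric.closedBall (extChartAt (𝓡 4) p p) ε' ⊆ (extChartAt (𝓡 4) p).target ∧
      (∀ (x : punctured p) (v : TangentSpace (𝓡 4) x), J x (J x v) = -v) ∧
      (∀ x₀ : punctured p, ContMDiffAt (𝓡 4)
        𝓘(ℝ, EuclideanSpace ℝ (Fin 4) →L[ℝ] EuclideanSpace ℝ (Fin 4)) ∞
        (inTangentCoordinates (𝓡 4) (𝓡 4) (id : punctured p → punctured p) id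
          (fun x => J x) x₀) x₀) ∧
      (∀ x : punctured p, InPuncturedChartBall p ε' x →
        ∀ (v : TangentSpace (𝓡 4) x) (b : EuclideanSpace ℝ (Fin 4)),
        inner ℝ (fderiv ℝ inversion (extChartAt (𝓡 4) p x.1 - extChartAt (𝓡 4) p p)
          (mfderiv (𝓡 4) 𝓘(ℝ, EuclideanSpace ℝ (Fin 4))
            (fun z : punctured p => extChartAt (𝓡 4) p z.1) x (J x v))) b =
        stdSymplecticForm (fderiv ℝ inversion (extChartAt (𝓡 4) p x.1 - extChartAt (𝓡 4) p p)
          (mfderiv (𝓡 4) 𝓘(ℝ, EuclideanSpace ℝ (Fin 4))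
            (fun z : punctured p => extChartAt (𝓡 4) p z.1) x v)) b) ∧
      ∃ γ : MForm (𝓡 4) (punctured p) ℝ 1, IsSmoothForm γ ∧
        ∀ (x : punctured p) (v : TangentSpace (𝓡 4) x), v ≠ 0 →
          0 < mextDeriv γ x ![v, J x v] := by
  obtain ⟨Φ, hΦ⟩ := palais_puncturedSphere_chartForm_holds S.carrier p hS
  exact weakTameExact_clauses_of_diffeomorph p Φ hΦ

open Literature.Topology.FourManifolds in
/-- **SPC4 (homotopy-sphere form) ⇒ `Target`**: the consistency direction of the crux — if every
homotopy 4-sphere is diffeomorphic to `S⁴` then route SullivanDual's `Target` holds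
(`WeakTameExact` holds by the previous theorem, and `target_of_weakTameExact`). In particular
`Target` is TRUE at every homotopy sphere diffeomorphic to `S⁴`. [folklore] -/
theorem target_of_forall_nonempty_diffeomorph_sphere
    (h : ∀ S : HomotopySphere 4,
      Nonempty (S.carrier ≃ₘ⟮𝓡 4, 𝓡 4⟯ Metric.sphere (0 : EuclideanSpace ℝ (Fin 5)) 1)) :
    Summit.SmoothPoincare4.SmoothPoincare4.Theses.SullivanDual.Target :=
  target_of_weakTameExact fun S p => weakTameExact_clauses_of_nonempty_diffeomorph_sphere S (h S) p

open Literature.Topology.FourManifolds Summit.SmoothPoincare4.SmoothPoincare4.Theses.SullivanDual in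
/-- **The transfer is lossless modulo the route's own supports: `Target ⇒ WeakTameExact`** given
`RelativeSullivanDuality` (Hahn–Banach, support item 7827) and the Gromov–McDuff chart form
`GromovChartForm` (support item 11129, the route's named-fact debt); `ClosedModelExtension` is
the landed `ClosedModelExtension_proof`. Chain (as in the route's `closes`): `Target` gives `J`,
`ε₁`; at `ε = min ε₀ ε₁` duality yields a symplectic form standard near `p`; the chart form
gives `Φ : Σ ∖ p ≃ₘ ℝ⁴` agreeing with the inverted chart near `p`; then
`weakTameExact_clauses_of_diffeomorph`. So `stub_weakTameExact` is exactly as strong as the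
crux. [folklore] -/
theorem weakTameExact_of_target (hT : Target) (hRSD : RelativeSullivanDuality)
    (hG : GromovChartForm) (S : HomotopySphere 4) (p : S.carrier) :
    ∃ (J : ∀ x : punctured p, TangentSpace (𝓡 4) x →L[ℝ] TangentSpace (𝓡 4) x) (ε' : ℝ),
      0 < ε' ∧ Metric.closedBall (extChartAt (𝓡 4) p p) ε' ⊆ (extChartAt (𝓡 4) p).target ∧
      (∀ (x : punctured p) (v : TangentSpace (𝓡 4) x), J x (J x v) = -v) ∧
      (∀ x₀ : punctured p, ContMDiffAt (𝓡 4)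
        𝓘(ℝ, EuclideanSpace ℝ (Fin 4) →L[ℝ] EuclideanSpace ℝ (Fin 4)) ∞
        (inTangentCoordinates (𝓡 4) (𝓡 4) (id : punctured p → punctured p) id
          (fun x => J x) x₀) x₀) ∧
      (∀ x : punctured p, InPuncturedChartBall p ε' x →
        ∀ (v : TangentSpace (𝓡 4) x) (b : EuclideanSpace ℝ (Fin 4)),
        inner ℝ (fderiv ℝ inversion (extChartAt (𝓡 4) p x.1 - extChartAt (𝓡 4) p p)
          (mfderiv (𝓡 4) 𝓘(ℝ, EuclideanSpace ℝ (Fin 4))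
            (fun z : punctured p => extChartAt (𝓡 4) p z.1) x (J x v))) b =
        stdSymplecticForm (fderiv ℝ inversion (extChartAt (𝓡 4) p x.1 - extChartAt (𝓡 4) p p)
          (mfderiv (𝓡 4) 𝓘(ℝ, EuclideanSpace ℝ (Fin 4))
            (fun z : punctured p => extChartAt (𝓡 4) p z.1) x v)) b) ∧
      ∃ γ : MForm (𝓡 4) (punctured p) ℝ 1, IsSmoothForm γ ∧
        ∀ (x : punctured p) (v : TangentSpace (𝓡 4) x), v ≠ 0 →
          0 < mextDeriv γ x ![v, J x v] := by
  obtain ⟨J, hJ2, hJs, ε₁, hε₁, hNoW⟩ := hT S p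
  obtain ⟨ε₀, hε₀, α₀, hα₀s, hα₀c, hα₀m⟩ := ClosedModelExtension_proof S p
  obtain ⟨sf, hsf, -⟩ := hRSD S p J (min ε₀ ε₁) (lt_min hε₀ hε₁) hJ2 hJs
    ⟨α₀, hα₀s, hα₀c, fun x hx v w =>
      hα₀m x ⟨hx.1, Metric.ball_subset_ball (min_le_left ε₀ ε₁) hx.2⟩ v w⟩
    (hNoW (min ε₀ ε₁) (lt_min hε₀ hε₁) (min_le_right ε₀ ε₁))
  obtain ⟨Φ, hΦ⟩ := hG S p (min ε₀ ε₁) sf hsf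
  exact weakTameExact_clauses_of_diffeomorph p Φ hΦ

end SullivanDual

end Summit.SmoothPoincare4.SmoothPoincare4.Theorems

end
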